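import Literature.NumberTheory.Automorphic.OrbitalIntegralLocallyConstantSubgroupChart
import Literature.NumberTheory.Automorphic.RegularOrbitChartUnitary
import Literature.LinearAlgebra.Matrix.SeparableCharpolyOpen
import Mathlib.Analysis.Normed.Ring.Units
import Mathlib.Analysis.SpecificLimits.Normed
import Mathlib.Analysis.Normed.Module.FiniteDimension
import HarnessLib

/-!
# Regular orbital integrals on a unitary group `U(σ, J)` are locally constant in Cayley chart coordinates (non-archimedean reading of
# Harish-Chandra's local constancy; N6ns-reg-(ii), FILE 3 — the `U(J)` dress)

Topic `NumberTheory/Automorphic`; namespace `Literature.NumberTheory.Automorphic`. THEOREMS ONLY (no definition, no instance, no notation, no named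
fact, no `sorry`). Cell `pub/hodgecm-mathlib`, programme P3a, road «N6-ns», brick **N6ns-reg-(ii)** FILE 3 (LEAD T8-2 (3), T8-15 (B)): the unitary
instantiation of ★ `OrbitalIntegralLocallyConstantSubgroupChart` (chart-datum layer) at A-p16's Cayley chart ★ `RegularOrbitChartUnitary`
(`exists_openPartialHomeomorph_cayleyConj_isImage_unitary`), with the Weyl separation ★ `CharpolyLocalRigidity` and the openness of the regular locus
★ `SeparableCharpolyOpen`.

THE STATEMENT (`exists_nhds_classOrbitalIntegral_mk_eq_of_cayleyChart`), matrix-level so that no auxiliary definition is needed: `E` a complete proper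
non-trivially normed field of characteristic zero, `σ` a continuous ring endomorphism, `J` invertible, `U = U(σ, J) ≤ GL_n(E)` (★ `unitaryGroupOfForm`),
`γ ∈ U` with separable characteristic polynomial, `ad = L_γ − R_γ`, `θ X = J⁻¹ σ(X)ᵀ J`, `c` the Cayley map (★ `cayley`), `m` a canonical orbital measure
family on `U` for a conjugation-invariant predicate `P` holding at regular semisimple elements. There are a radius `r > 0` and a neighbourhood `B₀` of `0`
in `M_n(E)` such that, with the CHART IMAGE `Ω = {u ∈ U | u = c(X) · γ c(Y) · c(X)⁻¹, X ∈ [γ, M] θ-skew, ‖X‖ ≤ r, Y ∈ C(γ) θ-skew, Y ∈ B₀}`: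
(N) `Ω` is a NEIGHBOURHOOD of `γ` in `U` (chart-3's `IsImage` + openness of `e`); (LC) for every LOCALLY CONSTANT `f : U → V` supported in `Ω` there is a
neighbourhood `W` of `0` with `Φ([u_Y], f; m) = Φ([γ], f; m)` for all `Y ∈ W ∩ B₀ ∩ C(γ)` θ-skew and `u_Y ∈ U` the element with matrix `γ c(Y)`.
Proof: the chart datum `s(X) = c(X)`, `τ(Y) = γ c(Y)` on the θ-skew parts of `[γ, M]`, `C(γ)` inside the unit ball (`1 ± X` units, Mathlib `Units.oneSub`;
continuity through `NormedRing.inverse_continuousAt` and the open embedding `GL_n ↪ M_n`), `K = {‖X‖ ≤ r}` compact (`E` proper), the box shrunk into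
the Weyl-separated neighbourhood (★ `exists_nhds_forall_conj_eq_imp_mem_centralizer`) and into the regular locus (★ `Subgroup.isOpen_setOf_charpoly_separable`);
then ★ `OrbitalMeasureFamily.IsCanonical.exists_nhds_classOrbitalIntegral_mk_eq_of_subgroup_chart`.

## References
* [HarishChandra1970] Harish-Chandra (notes by G. van Dijk), *Harmonic Analysis on Reductive p-adic Groups*, LNM 162 (1970), Part I §3.
* [Rogawski1990] J. D. Rogawski, *Automorphic Representations of Unitary Groups in Three Variables*, Ann. of Math. Stud. 123 (1990), §3.1 p. 19; §4.3 p. 43; §4.9 p. 54.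
* [Weyl1939] H. Weyl, *The Classical Groups*, Princeton (1939), Ch. II §10 (Cayley parametrisation).
-/

set_option autoImplicit false

noncomputable section

open MeasureTheory Measure Set Filter Topology Polynomial
open Literature.Analysis.Calculus Literature.LinearAlgebra.Matrix
open scoped Matrix.Norms.Operator Matrix MatrixGroups

namespace Literature.NumberTheory.Automorphic

/-! ## §1 Small elements of a complete normed ring: `1 ± X` are units, `c` is continuous, the unit-valued Cayley map is continuous -/

section NormedRing

variable {R : Type*} [NormedRing R] [HasSummableGeomSeries R]

/-- The Cayley map `c(X) = (1 − X)(1 + X)⁻¹` is continuous at every `X` with `1 + X` a unit (`Ring.inverse` is continuous at units of a complete normed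
ring, Mathlib `NormedRing.inverse_continuousAt`). [cite: Weyl1939, Ch. II §10] -/
theorem continuousAt_cayley_of_isUnit {X : R} (h : IsUnit (1 + X)) : ContinuousAt (cayley : R → R) X := by
  obtain ⟨u, hu⟩ := h
  have h1 : ContinuousAt (fun Y : R => Ring.inverse (1 + Y)) X := by
    have hc := NormedRing.inverse_continuousAt u
    rw [hu] at hc
    exact ContinuousAt.comp (g := Ring.inverse) (f := fun Y : R => 1 + Y) hc (continuous_const.add continuous_id).continuousAt
  have h2 : ContinuousAt (fun Y : R => (1 - Y) * Ring.inverse (1 + Y)) X := (continuous_const.sub continuous_id).continuousAt.mul h1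
  have hfun : (cayley : R → R) = fun Y : R => (1 - Y) * Ring.inverse (1 + Y) := funext fun Y => cayley_def Y
  rw [hfun]
  exact h2

omit [HasSummableGeomSeries R] in
/-- `c(0) = 1`. [cite: Weyl1939, Ch. II §10] -/
theorem cayley_zero : cayley (0 : R) = 1 := by
  rw [cayley_def, sub_zero, add_zero, Ring.inverse_one, mul_one]

/-- **The unit-valued Cayley map `X ↦ c(X) ∈ Rˣ` is continuous on any subtype where `1 ± X` are units** (the inclusion `Rˣ ↪ R` is an open
embedding for a complete normed ring, Mathlib `Units.isOpenEmbedding_val`). [cite: Weyl1939, Ch. II §10] -/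
theorem continuous_cayleyUnit {S : Set R} (h1 : ∀ x : ↥S, IsUnit (1 + (x : R))) (h2 : ∀ x : ↥S, IsUnit (1 - (x : R))) :
    Continuous fun x : ↥S => (isUnit_cayley (h1 x) (h2 x)).unit := by
  refine (Units.isOpenEmbedding_val (R := R)).isEmbedding.continuous_iff.2 ?_
  have hfun : (Units.val ∘ fun x : ↥S => (isUnit_cayley (h1 x) (h2 x)).unit) = fun x : ↥S => cayley (x : R) :=
    funext fun x => IsUnit.unit_spec _
  rw [hfun]
  exact continuous_iff_continuousAt.2 fun x => (continuousAt_cayley_of_isUnit (h1 x)).comp continuous_subtype_val.continuousAt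

end NormedRing

/-! ## §2 The unitary reading -/

section Unitary

variable {E : Type*} [NontriviallyNormedField E] [CompleteSpace E] {n : Type*} [Fintype n] [DecidableEq n]

/-- The θ-skew part of a closed submodule, cut by a closed ball, is compact (`E` proper ⇒ `M_n(E)` proper). [cite: Weyl1939, Ch. II §10] -/
theorem isCompact_inter_skew_closedBall [ProperSpace E] (σ : E →+* E) (hσ : Continuous σ) (J : Matrix n n E)
    (C : Submodule E (Matrix n n E)) (r : ℝ) :
    IsCompact ({X : Matrix n n E | X ∈ C ∧ J⁻¹ * (X.map σ)ᵀ * J = -X} ∩ Metric.closedBall 0 r) := by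
  haveI : ProperSpace (Matrix n n E) := FiniteDimensional.proper E (Matrix n n E)
  have hθ : Continuous fun X : Matrix n n E => J⁻¹ * (X.map σ)ᵀ * J :=
    (continuous_const.mul ((continuous_id.matrix_map hσ).matrix_transpose)).mul continuous_const
  refine (isCompact_closedBall (0 : Matrix n n E) r).inter_left (IsClosed.inter ?_ (isClosed_eq hθ continuous_neg))
  exact C.closed_of_finiteDimensional

/-- **The chart image of the Cayley chart is a neighbourhood of `γ` in `U(σ, J)`** (clause (N)): for ANY `r > 0` and ANY open `B₀ ∋ 0`, the set of
`u ∈ U` of the form `c(X) · γ c(Y) · c(X)⁻¹` with `X ∈ [γ, M]` θ-skew, `‖X‖ ≤ r`, `Y ∈ C(γ)` θ-skew, `Y ∈ B₀` contains a neighbourhood of `γ` — by the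
`IsImage` clause of A-p16's chart (★ `exists_openPartialHomeomorph_cayleyConj_isImage_unitary`) and openness of the chart map.
[cite: HarishChandra1970, Part I §3] [cite: Weyl1939, Ch. II §10] -/
theorem cayleyChartImage_mem_nhds [CharZero E] (σ : E →+* E) (hσ : Continuous σ) {J : Matrix n n E} (hJ : IsUnit J.det)
    (γ : ↥(unitaryGroupOfForm σ J)) (hγ : ((γ : GL n E) : Matrix n n E).charpoly.Separable)
    {r : ℝ} (hr : 0 < r) {B₀ : Set (Matrix n n E)} (hB₀o : IsOpen B₀) (hB₀0 : (0 : Matrix n n E) ∈ B₀) :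
    {u : ↥(unitaryGroupOfForm σ J) | ∃ X Y : Matrix n n E,
        X ∈ LinearMap.range (LinearMap.mulLeft E ((γ : GL n E) : Matrix n n E) - LinearMap.mulRight E ((γ : GL n E) : Matrix n n E)) ∧
        J⁻¹ * (X.map σ)ᵀ * J = -X ∧ ‖X‖ ≤ r ∧
        Y ∈ LinearMap.ker (LinearMap.mulLeft E ((γ : GL n E) : Matrix n n E) - LinearMap.mulRight E ((γ : GL n E) : Matrix n n E)) ∧
        J⁻¹ * (Y.map σ)ᵀ * J = -Y ∧ Y ∈ B₀ ∧
        ((u : GL n E) : Matrix n n E) = cayley X * (((γ : GL n E) : Matrix n n E) * cayley Y) * Ring.inverse (cayley X)} ∈ 𝓝 γ := by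
  haveI : CompleteSpace (Matrix n n E) := FiniteDimensional.complete E (Matrix n n E)
  obtain ⟨e, h0, -, he, -, hIm⟩ := exists_openPartialHomeomorph_cayleyConj_isImage_unitary σ hσ hJ (γ : GL n E) γ.2 hγ
  -- the open box `O ⊆ e.source`
  have hOo : IsOpen (e.source ∩ {p : ↥(LinearMap.range (LinearMap.mulLeft E ((γ : GL n E) : Matrix n n E) -
      LinearMap.mulRight E ((γ : GL n E) : Matrix n n E))) × ↥(LinearMap.ker (LinearMap.mulLeft E ((γ : GL n E) : Matrix n n E) -
      LinearMap.mulRight E ((γ : GL n E) : Matrix n n E))) | ‖(p.1 : Matrix n n E)‖ < r ∧ (p.2 : Matrix n n E) ∈ B₀}) := by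
    refine e.open_source.inter (IsOpen.inter ?_ ?_)
    · exact isOpen_lt (continuous_norm.comp (continuous_subtype_val.comp continuous_fst)) continuous_const
    · exact hB₀o.preimage (continuous_subtype_val.comp continuous_snd)
  have h0O : (0 : ↥(LinearMap.range (LinearMap.mulLeft E ((γ : GL n E) : Matrix n n E) - LinearMap.mulRight E ((γ : GL n E) : Matrix n n E))) ×
      ↥(LinearMap.ker (LinearMap.mulLeft E ((γ : GL n E) : Matrix n n E) - LinearMap.mulRight E ((γ : GL n E) : Matrix n n E)))) ∈
      e.source ∩ {p | ‖(p.1 : Matrix n n E)‖ < r ∧ (p.2 : Matrix n n E) ∈ B₀} := by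
    refine ⟨h0, ?_, ?_⟩
    · show ‖((0 : ↥(LinearMap.range (LinearMap.mulLeft E ((γ : GL n E) : Matrix n n E) -
        LinearMap.mulRight E ((γ : GL n E) : Matrix n n E)))) : Matrix n n E)‖ < r
      rw [ZeroMemClass.coe_zero, norm_zero]
      exact hr
    · show ((0 : ↥(LinearMap.ker (LinearMap.mulLeft E ((γ : GL n E) : Matrix n n E) -
        LinearMap.mulRight E ((γ : GL n E) : Matrix n n E)))) : Matrix n n E) ∈ B₀
      rw [ZeroMemClass.coe_zero]
      exact hB₀0
  have hOimg := e.isOpen_image_of_subset_source hOo Set.inter_subset_left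
  have hγO : ((γ : GL n E) : Matrix n n E) ∈ e '' (e.source ∩ {p | ‖(p.1 : Matrix n n E)‖ < r ∧ (p.2 : Matrix n n E) ∈ B₀}) := by
    refine ⟨_, h0O, ?_⟩
    rw [he]
    simp only [Prod.fst_zero, Prod.snd_zero, ZeroMemClass.coe_zero, cayley_zero, one_mul, mul_one, Ring.inverse_one]
  refine Filter.mem_of_superset ((hOimg.preimage (Units.continuous_val.comp continuous_subtype_val)).mem_nhds hγO) ?_
  rintro u ⟨p, hpO, hpu⟩
  have hpu' : e p = ((u : GL n E) : Matrix n n E) := hpu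
  have hpS : e p ∈ {W : Matrix n n E | ∃ g ∈ unitaryGroupOfForm σ J, (g : Matrix n n E) = W} := ⟨(u : GL n E), u.2, hpu'.symm⟩
  have hpθ := (hIm hpO.1).1 hpS
  refine ⟨(p.1 : Matrix n n E), (p.2 : Matrix n n E), p.1.2, hpθ.1, le_of_lt hpO.2.1, p.2.2, hpθ.2, hpO.2.2, ?_⟩
  rw [← hpu', he]

variable [ProperSpace E]

/-- **N6ns-reg-(ii), `U(J)` FORM — REGULAR ORBITAL INTEGRALS OF A CANONICAL FAMILY ON `U(σ, J)` ARE LOCALLY CONSTANT IN CAYLEY CHART COORDINATES.**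
See the module docstring for the reading of `r`, `B₀`, the chart image `Ω` (clause (N): a neighbourhood of `γ` in `U`, ★ `cayleyChartImage_mem_nhds`) and the
conclusion (LC). [cite: HarishChandra1970, Part I §3] [cite: Rogawski1990, §3.1 p. 19; §4.3 p. 43; §4.9 p. 54] [cite: Weyl1939, Ch. II §10] -/
theorem exists_nhds_classOrbitalIntegral_mk_eq_of_cayleyChart [CharZero E] (σ : E →+* E) (hσ : Continuous σ) {J : Matrix n n E} (hJ : IsUnit J.det)
    [LocallyCompactSpace ↥(unitaryGroupOfForm σ J)] [SecondCountableTopology ↥(unitaryGroupOfForm σ J)]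
    [MeasurableSpace ↥(unitaryGroupOfForm σ J)] [BorelSpace ↥(unitaryGroupOfForm σ J)]
    [∀ g : ↥(unitaryGroupOfForm σ J), MeasurableSpace (↥(unitaryGroupOfForm σ J) ⧸ Subgroup.centralizer ({g} : Set ↥(unitaryGroupOfForm σ J)))]
    [∀ g : ↥(unitaryGroupOfForm σ J), BorelSpace (↥(unitaryGroupOfForm σ J) ⧸ Subgroup.centralizer ({g} : Set ↥(unitaryGroupOfForm σ J)))]
    (γ : ↥(unitaryGroupOfForm σ J)) (hγ : ((γ : GL n E) : Matrix n n E).charpoly.Separable)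
    {P : ↥(unitaryGroupOfForm σ J) → Prop} (hP : ∀ g x : ↥(unitaryGroupOfForm σ J), P g → P (x * g * x⁻¹))
    (hPreg : ∀ u : ↥(unitaryGroupOfForm σ J), ((u : GL n E) : Matrix n n E).charpoly.Separable → P u)
    {ν : Measure ↥(unitaryGroupOfForm σ J)} [IsHaarMeasure ν] [ν.IsMulRightInvariant]
    {m : OrbitalMeasureFamily ↥(unitaryGroupOfForm σ J)} (hm : m.IsCanonical P ν)
    {V : Type*} [NormedAddCommGroup V] [NormedSpace ℝ V] :
    ∃ r : ℝ, 0 < r ∧ ∃ B₀ : Set (Matrix n n E), B₀ ∈ 𝓝 (0 : Matrix n n E) ∧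
      {u : ↥(unitaryGroupOfForm σ J) | ∃ X Y : Matrix n n E,
          X ∈ LinearMap.range (LinearMap.mulLeft E ((γ : GL n E) : Matrix n n E) - LinearMap.mulRight E ((γ : GL n E) : Matrix n n E)) ∧
          J⁻¹ * (X.map σ)ᵀ * J = -X ∧ ‖X‖ ≤ r ∧
          Y ∈ LinearMap.ker (LinearMap.mulLeft E ((γ : GL n E) : Matrix n n E) - LinearMap.mulRight E ((γ : GL n E) : Matrix n n E)) ∧
          J⁻¹ * (Y.map σ)ᵀ * J = -Y ∧ Y ∈ B₀ ∧
          ((u : GL n E) : Matrix n n E) = cayley X * (((γ : GL n E) : Matrix n n E) * cayley Y) * Ring.inverse (cayley X)} ∈ 𝓝 γ ∧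
      ∀ f : ↥(unitaryGroupOfForm σ J) → V, IsLocallyConstant f →
        (∀ u, f u ≠ 0 → ∃ X Y : Matrix n n E,
          X ∈ LinearMap.range (LinearMap.mulLeft E ((γ : GL n E) : Matrix n n E) - LinearMap.mulRight E ((γ : GL n E) : Matrix n n E)) ∧
          J⁻¹ * (X.map σ)ᵀ * J = -X ∧ ‖X‖ ≤ r ∧
          Y ∈ LinearMap.ker (LinearMap.mulLeft E ((γ : GL n E) : Matrix n n E) - LinearMap.mulRight E ((γ : GL n E) : Matrix n n E)) ∧
          J⁻¹ * (Y.map σ)ᵀ * J = -Y ∧ Y ∈ B₀ ∧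
          ((u : GL n E) : Matrix n n E) = cayley X * (((γ : GL n E) : Matrix n n E) * cayley Y) * Ring.inverse (cayley X)) →
        ∃ W ∈ 𝓝 (0 : Matrix n n E), ∀ Y ∈ W, Y ∈ B₀ →
          Y ∈ LinearMap.ker (LinearMap.mulLeft E ((γ : GL n E) : Matrix n n E) - LinearMap.mulRight E ((γ : GL n E) : Matrix n n E)) →
          J⁻¹ * (Y.map σ)ᵀ * J = -Y →
          ∀ uY : ↥(unitaryGroupOfForm σ J), ((uY : GL n E) : Matrix n n E) = ((γ : GL n E) : Matrix n n E) * cayley Y →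
            classOrbitalIntegral m f (ConjClasses.mk uY) = classOrbitalIntegral m f (ConjClasses.mk γ) := by
  haveI : CompleteSpace (Matrix n n E) := FiniteDimensional.complete E (Matrix n n E)
  haveI : HasSummableGeomSeries (Matrix n n E) :=
    @instHasSummableGeomSeriesOfCompleteSpace (Matrix n n E) _ (FiniteDimensional.complete E (Matrix n n E))
  have h1S : ∀ {X : Matrix n n E}, ‖X‖ < 1 → IsUnit (1 + X) := fun {X} h => by
    have hu := (Units.oneSub (-X) (by rwa [norm_neg])).isUnit
    rwa [Units.val_oneSub, sub_neg_eq_add] at hu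
  have h2S : ∀ {X : Matrix n n E}, ‖X‖ < 1 → IsUnit (1 - X) := fun {X} h => by
    have hu := (Units.oneSub X h).isUnit
    rwa [Units.val_oneSub] at hu
  -- the small θ-skew sets and the chart datum `s`, `τ` (Cayley units)
  let SA : Set (Matrix n n E) := {X | X ∈ LinearMap.range (LinearMap.mulLeft E ((γ : GL n E) : Matrix n n E) -
      LinearMap.mulRight E ((γ : GL n E) : Matrix n n E)) ∧ J⁻¹ * (X.map σ)ᵀ * J = -X ∧ ‖X‖ < 1}
  let SB : Set (Matrix n n E) := {Y | Y ∈ LinearMap.ker (LinearMap.mulLeft E ((γ : GL n E) : Matrix n n E) -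
      LinearMap.mulRight E ((γ : GL n E) : Matrix n n E)) ∧ J⁻¹ * (Y.map σ)ᵀ * J = -Y ∧ ‖Y‖ < 1}
  have hSA1 : ∀ X ∈ SA, ‖X‖ < 1 := fun X hX => hX.2.2
  have hSB1 : ∀ Y ∈ SB, ‖Y‖ < 1 := fun Y hY => hY.2.2
  have hcU : ∀ {X : Matrix n n E}, J⁻¹ * (X.map σ)ᵀ * J = -X → (hp : IsUnit (1 + X)) → (hq : IsUnit (1 - X)) →
      (isUnit_cayley hp hq).unit ∈ unitaryGroupOfForm σ J := fun {X} hX hp hq => by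
    obtain ⟨g, hg, hgc⟩ := cayley_mem_unitaryGroupOfForm (σ := σ) hJ hX hp hq
    have hge : (isUnit_cayley hp hq).unit = g := Units.ext (by rw [IsUnit.unit_spec, hgc])
    rw [hge]
    exact hg
  let s : ↥SA → ↥(unitaryGroupOfForm σ J) := fun a =>
    ⟨(isUnit_cayley (h1S (hSA1 a a.2)) (h2S (hSA1 a a.2))).unit,
      hcU a.2.2.1 (h1S (hSA1 a a.2)) (h2S (hSA1 a a.2))⟩
  let cB : ↥SB → ↥(unitaryGroupOfForm σ J) := fun b =>
    ⟨(isUnit_cayley (h1S (hSB1 b b.2)) (h2S (hSB1 b b.2))).unit,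
      hcU b.2.2.1 (h1S (hSB1 b b.2)) (h2S (hSB1 b b.2))⟩
  let τ : ↥SB → ↥(unitaryGroupOfForm σ J) := fun b => γ * cB b
  have hsval : ∀ a : ↥SA, (((s a : ↥(unitaryGroupOfForm σ J)) : GL n E) : Matrix n n E) = cayley (a : Matrix n n E) := fun a => rfl
  have hτval : ∀ b : ↥SB, (((τ b : ↥(unitaryGroupOfForm σ J)) : GL n E) : Matrix n n E) =
      ((γ : GL n E) : Matrix n n E) * cayley (b : Matrix n n E) := fun b => rfl
  have hs : Continuous s :=
    (continuous_cayleyUnit (S := SA) (fun a => h1S (hSA1 a a.2)) (fun a => h2S (hSA1 a a.2))).subtype_mk _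
  have hτ : Continuous τ :=
    continuous_const.mul ((continuous_cayleyUnit (S := SB) (fun b => h1S (hSB1 b b.2)) (fun b => h2S (hSB1 b b.2))).subtype_mk _)
  -- the base point `b₀ = 0`, `τ b₀ = γ`
  have hθ0 : J⁻¹ * ((0 : Matrix n n E).map σ)ᵀ * J = -0 := by
    rw [Matrix.map_zero σ (map_zero σ), Matrix.transpose_zero, Matrix.mul_zero, Matrix.zero_mul, neg_zero]
  let b₀ : ↥SB := ⟨0, LinearMap.mem_ker.2 (map_zero _), hθ0, by rw [norm_zero]; exact one_pos⟩
  have hτ₀ : τ b₀ = γ := by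
    apply Subtype.ext
    apply Units.ext
    rw [hτval b₀, show ((b₀ : ↥SB) : Matrix n n E) = 0 from rfl, cayley_zero, mul_one]
  -- commuting: `Y ∈ C(γ)` ⇒ `γ c(Y) ∈ Z_U(γ)`
  have hcomm : ∀ b : ↥SB, τ b ∈ Subgroup.centralizer ({γ} : Set ↥(unitaryGroupOfForm σ J)) := fun b => by
    have hk : Commute ((γ : GL n E) : Matrix n n E) (b : Matrix n n E) := by
      have h := LinearMap.mem_ker.1 b.2.1
      rw [LinearMap.sub_apply, LinearMap.mulLeft_apply, LinearMap.mulRight_apply, sub_eq_zero] at h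
      exact h
    have hc := commute_cayley hk (h1S (hSB1 b b.2))
    rw [Subgroup.mem_centralizer_singleton_iff]
    apply Subtype.ext
    apply Units.ext
    show (((τ b : ↥(unitaryGroupOfForm σ J)) : GL n E) : Matrix n n E) * ((γ : GL n E) : Matrix n n E) =
      ((γ : GL n E) : Matrix n n E) * (((τ b : ↥(unitaryGroupOfForm σ J)) : GL n E) : Matrix n n E)
    rw [hτval, mul_assoc, ← hc.eq]
  -- the Weyl-separated box and the regular box
  obtain ⟨W₁, hW₁, hsepW⟩ := exists_nhds_forall_conj_eq_imp_mem_centralizer (U := unitaryGroupOfForm σ J) hγ τ hτ.continuousAt hτ₀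
  obtain ⟨V₁, hV₁, hV₁W⟩ := (mem_nhds_subtype SB b₀ W₁).1 hW₁
  obtain ⟨O₁, hO₁V, hO₁o, hO₁0⟩ := _root_.mem_nhds_iff.1 hV₁
  have hregO : IsOpen {u : ↥(unitaryGroupOfForm σ J) | ((u : GL n E) : Matrix n n E).charpoly.Separable} :=
    (unitaryGroupOfForm σ J).isOpen_setOf_charpoly_separable
  have hW₂ : τ ⁻¹' {u : ↥(unitaryGroupOfForm σ J) | ((u : GL n E) : Matrix n n E).charpoly.Separable} ∈ 𝓝 b₀ := by
    refine hτ.continuousAt.preimage_mem_nhds (hregO.mem_nhds ?_)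
    show (((τ b₀ : ↥(unitaryGroupOfForm σ J)) : GL n E) : Matrix n n E).charpoly.Separable
    rw [hτ₀]
    exact hγ
  obtain ⟨V₂, hV₂, hV₂W⟩ := (mem_nhds_subtype SB b₀ _).1 hW₂
  obtain ⟨O₂, hO₂V, hO₂o, hO₂0⟩ := _root_.mem_nhds_iff.1 hV₂
  -- the radius `r = 1/2` and the box `B₀ = O₁ ∩ O₂ ∩ ball 0 1`
  have hB₀o : IsOpen (O₁ ∩ O₂ ∩ Metric.ball (0 : Matrix n n E) 1) := (hO₁o.inter hO₂o).inter Metric.isOpen_ball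
  have hB₀0 : (0 : Matrix n n E) ∈ O₁ ∩ O₂ ∩ Metric.ball (0 : Matrix n n E) 1 := ⟨⟨hO₁0, hO₂0⟩, Metric.mem_ball_self one_pos⟩
  refine ⟨1 / 2, one_half_pos, O₁ ∩ O₂ ∩ Metric.ball 0 1, hB₀o.mem_nhds hB₀0,
    cayleyChartImage_mem_nhds σ hσ hJ γ hγ one_half_pos hB₀o hB₀0, fun f hf hfsupp => ?_⟩
  -- (LC) through ★ `exists_nhds_classOrbitalIntegral_mk_eq_of_subgroup_chart`
  have hKc : IsCompact {a : ↥SA | ‖(a : Matrix n n E)‖ ≤ 1 / 2} := by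
    rw [Topology.IsEmbedding.subtypeVal.isCompact_iff]
    have himg : Subtype.val '' {a : ↥SA | ‖(a : Matrix n n E)‖ ≤ 1 / 2} =
        {X : Matrix n n E | X ∈ LinearMap.range (LinearMap.mulLeft E ((γ : GL n E) : Matrix n n E) -
          LinearMap.mulRight E ((γ : GL n E) : Matrix n n E)) ∧ J⁻¹ * (X.map σ)ᵀ * J = -X} ∩ Metric.closedBall 0 (1 / 2) := by
      ext X
      constructor
      · rintro ⟨a, ha, rfl⟩
        exact ⟨⟨a.2.1, a.2.2.1⟩, by rw [Metric.mem_closedBall, dist_zero_right]; exact ha⟩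
      · rintro ⟨⟨h1, h2⟩, h3⟩
        rw [Metric.mem_closedBall, dist_zero_right] at h3
        exact ⟨⟨X, h1, h2, lt_of_le_of_lt h3 (by norm_num)⟩, h3, rfl⟩
    rw [himg]
    exact isCompact_inter_skew_closedBall σ hσ J _ _
  have hb₀ : b₀ ∈ {b : ↥SB | (b : Matrix n n E) ∈ O₁ ∩ O₂ ∩ Metric.ball (0 : Matrix n n E) 1} := hB₀0
  have hreg : ∀ b ∈ {b : ↥SB | (b : Matrix n n E) ∈ O₁ ∩ O₂ ∩ Metric.ball (0 : Matrix n n E) 1},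
      P (τ b) ∧ (((τ b : ↥(unitaryGroupOfForm σ J)) : GL n E) : Matrix n n E).charpoly.Separable ∧
        τ b ∈ Subgroup.centralizer ({τ b₀} : Set ↥(unitaryGroupOfForm σ J)) := fun b hb =>
    ⟨hPreg _ (hV₂W (hO₂V hb.1.2)), hV₂W (hO₂V hb.1.2), by rw [hτ₀]; exact hcomm b⟩
  have hsep : ∀ b ∈ {b : ↥SB | (b : Matrix n n E) ∈ O₁ ∩ O₂ ∩ Metric.ball (0 : Matrix n n E) 1},
      ∀ b' ∈ {b : ↥SB | (b : Matrix n n E) ∈ O₁ ∩ O₂ ∩ Metric.ball (0 : Matrix n n E) 1},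
      ∀ y : ↥(unitaryGroupOfForm σ J), y * τ b * y⁻¹ = τ b' → y ∈ Subgroup.centralizer ({τ b} : Set ↥(unitaryGroupOfForm σ J)) :=
    fun b hb b' hb' y hy => hsepW b (hV₁W (hO₁V hb.1.1)) b' (hV₁W (hO₁V hb'.1.1)) (hcomm b) (hcomm b') y hy
  have hγsep : (((τ b₀ : ↥(unitaryGroupOfForm σ J)) : GL n E) : Matrix n n E).charpoly.Separable := by rw [hτ₀]; exact hγ
  have hconjval : ∀ x t : GL n E, (((x * t * x⁻¹ : GL n E)) : Matrix n n E) =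
      (x : Matrix n n E) * (t : Matrix n n E) * Ring.inverse (x : Matrix n n E) := fun x t => by
    rw [Units.val_mul, Units.val_mul, Ring.inverse_unit]
  have hfΩ : ∀ u, f u ≠ 0 → u ∈ (fun p : ↥SA × ↥SB => s p.1 * τ p.2 * (s p.1)⁻¹) ''
      ({a : ↥SA | ‖(a : Matrix n n E)‖ ≤ 1 / 2} ×ˢ {b : ↥SB | (b : Matrix n n E) ∈ O₁ ∩ O₂ ∩ Metric.ball (0 : Matrix n n E) 1}) := by
    intro u hu
    obtain ⟨X, Y, hXr, hXθ, hXn, hYk, hYθ, hYB, huXY⟩ := hfsupp u hu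
    have hY1 : ‖Y‖ < 1 := by
      have h := hYB.2
      rwa [Metric.mem_ball, dist_zero_right] at h
    refine ⟨(⟨X, hXr, hXθ, lt_of_le_of_lt hXn (by norm_num)⟩, ⟨Y, hYk, hYθ, hY1⟩), ⟨hXn, hYB⟩, ?_⟩
    apply Subtype.ext
    show ((s ⟨X, hXr, hXθ, lt_of_le_of_lt hXn (by norm_num)⟩ : GL n E) * (τ ⟨Y, hYk, hYθ, hY1⟩ : GL n E) *
        (s ⟨X, hXr, hXθ, lt_of_le_of_lt hXn (by norm_num)⟩ : GL n E)⁻¹ : GL n E) = (u : GL n E)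
    apply Units.ext
    rw [hconjval, huXY]
    rfl
  obtain ⟨W, hW, hconcl⟩ := hm.exists_nhds_classOrbitalIntegral_mk_eq_of_subgroup_chart hP s hs τ hτ hKc hb₀ hγsep hreg hsep hf hfΩ
  obtain ⟨Vw, hVw, hVwW⟩ := (mem_nhds_subtype SB b₀ W).1 hW
  refine ⟨Vw, hVw, fun Y hYV hYB hYk hYθ uY huY => ?_⟩
  have hY1 : ‖Y‖ < 1 := by
    have h := hYB.2
    rwa [Metric.mem_ball, dist_zero_right] at h
  have key := hconcl ⟨Y, hYk, hYθ, hY1⟩ (hVwW hYV) hYB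
  have huY' : uY = τ ⟨Y, hYk, hYθ, hY1⟩ := by
    apply Subtype.ext
    apply Units.ext
    rw [huY]
    rfl
  rw [huY', key, hτ₀]

end Unitary

end Literature.NumberTheory.Automorphic

end
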